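import Summits.HodgeConjecture.CorCM.AbelianOddPartGroupLemmas
import Summits.HodgeConjecture.CorCM.AbelianTwoPowerClassification
import Summits.HodgeConjecture.CorCM.CyclicCMTypesClassification
import HarnessLib

/-!
# THE CLASSIFICATION of the abelian CM fields all of whose simple CM abelian varieties are nondegenerate —
# the degrees with an odd part, and the complete statement

COR-CM (cell `pub-hodgecm2`), binder seat b04 (gen 18), count-neutral claim ABELIAN-ODD-PART, part IIIb.
KERNEL ONLY: theorems; no definition, no named fact, no `sorry`.  `HC_CM` is neither used nor claimed.

**Theorem (`forall_isPrimitive_isNondegenerate_iff_of_ne_one`).**  Let `K` be a CM field, Galois over `ℚ` with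
ABELIAN Galois group, `[K:ℚ] = 2^{a+1} m` with `m` odd and `m ≠ 1`.  Every PRIMITIVE CM type of `K` is
NONDEGENERATE (equivalently every SIMPLE abelian variety with complex multiplication by `K` is nondegenerate:
`Hdg = Div` on all powers, the Hodge conjecture for all powers) **iff `Gal(K/ℚ)` is CYCLIC and `m` is PRIME.**

* ⟸ is gen 11 (`CyclicTwoPower.isNondegenerate_of_isPrimitive_of_isCyclic`, the degree `2^{a+1}·prime` theorem);
* cyclic with `m` composite is gen 12 (`CyclicComposite.forall_isPrimitive_isNondegenerate_iff_of_isCyclic`,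
  Dodson's block types and their non-split inflations);
* NON-cyclic is NEW (`exists_isPrimitive_not_isNondegenerate_of_not_isCyclic`): a finite commutative group with at
  most `p` solutions of `x^p = 1` for every prime `p` is cyclic (§1), so a non-cyclic Galois group has either a
  second involution `t ≠ c` — then with an automorphism of odd prime order `q ∣ m` the atom `ℤ/2 × (ℤ/2 × ℤ/q)`
  (balanced, Weil type) — or two independent automorphisms of an odd prime order `p` — then the atom
  `ℤ/2 × (ℤ/p × ℤ/p)`, whose primitive degenerate CM sets are killed by an odd character through
  `1 + ζ_p + ⋯ + ζ_p^{p−1} = 0` and are balanced over NO subgroup (parts IIb/IIIa); in both cases the induced CM set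
  on `Gal(K/ℚ)` is a PRIMITIVE DEGENERATE CM type by Kubota's Lemma 2 (part I).

With gen 16's classification in `2`-power degree (`AbelianTwoPowerClassification.forall_isPrimitive_isNondegenerate_iff`)
this gives **the complete classification of ABELIAN CM fields** (`forall_isPrimitive_isNondegenerate_iff_abelian`,
`forall_isSimple_isNondegenerate_iff_abelian`): all simple CM abelian varieties with CM by `K` are nondegenerate iff
EITHER `m = 1` and ((α) `c` lies in a cyclic subgroup of index `≤ 2`, or (β) `[K:ℚ] ≤ 8`, or (γ) `[K:ℚ] = 16` and
all squares lie in `{1, c}`) OR `m` is prime and `Gal(K/ℚ)` is cyclic.  In the good cases the Hodge conjecture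
holds for all powers of all simple CM abelian varieties with CM by `K`, unconditionally
(`hodgeConjectureFor_pow_of_isSimple_of_isCyclic`); in every other case a SIMPLE DEGENERATE CM abelian variety of
dimension `[K:ℚ]/2` with an exceptional Hodge class on some power exists (`exists_simple_degenerate_of_not_isCyclic`,
gen 12, gen 16).

## References

* [Kubota1965] T. Kubota, *On the field extension by complex multiplication*, Trans. AMS 118 (1965), §4 Lemma 2.
* [Shimura1998] G. Shimura, *Abelian Varieties with Complex Multiplication and Modular Functions*, §6.2 Thm. 3,
  §8.1, §8.2 Prop. 26.
* [Gordon1999HodgeAVSurvey] B. B. Gordon, *A survey of the Hodge conjecture for abelian varieties*, 5.13, Thm. 6.4,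
  Prop. 9.4.1, §9.4.2, §9.4.3.
* [Dodson1984] B. Dodson, *The structure of Galois groups of CM-fields*, Trans. AMS 283 (1984), §3.1.1, §3.2.1.
-/

noncomputable section

open CategoryTheory CategoryTheory.Limits NumberField

namespace Summit.HodgeConjecture.CorCM.AbelianOddPart

open Literature.NumberTheory.ComplexMultiplication
open Literature.AlgebraicGeometry.Motives (AbelianVariety CMType)
open Literature.AlgebraicGeometry.HodgeTheory
open Literature.AlgebraicGeometry.ComplexMultiplication (IsCMTypeRealisation isSimple_iff_isPrimitive)
open Literature.AlgebraicGeometry.Pohlmann1968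
open Literature.Barriers.HodgeConjecture (divisorClassesSpan)
open Summit.HodgeConjecture.CorCM.GaloisOctic (complexConj_restrictScalars_ne_one complexConj_mul_self)
open Summit.HodgeConjecture.CorCM.AbelianSixteen (exists_simple_realisation_of_isPrimitive)
open Summit.HodgeConjecture.CorCM.CyclicTwoPower (isNondegenerate_of_isPrimitive_of_isCyclic)
open Summit.HodgeConjecture.CorCM.CyclicComposite (forall_isPrimitive_isNondegenerate_iff_of_isCyclic)

open scoped Classical

section Group

variable {G : Type*} [CommGroup G] [Fintype G]

/-! ## §1 A finite abelian group with at most `p` solutions of `x^p = 1` for every prime `p` is cyclic -/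

/-- **Prime-wise counting criterion.**  In a finite commutative group with `#{x : x^p = 1} ≤ p` for every prime
`p`, `#{x : x^n = 1} ≤ n` for every `n > 0` (induction: `x ↦ x^p`, `p` the least prime factor of `n`, maps
`{x^n = 1}` into `{x^{n/p} = 1}` with fibres of size `≤ #{x^p = 1}`). [folklore] -/
theorem card_filter_pow_eq_one_le (h : ∀ p : ℕ, p.Prime → (Finset.univ.filter fun x : G => x ^ p = 1).card ≤ p)
    (n : ℕ) (hn : 0 < n) : (Finset.univ.filter fun x : G => x ^ n = 1).card ≤ n := by
  induction n using Nat.strong_induction_on with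
  | _ n ih =>
    by_cases h1 : n = 1
    · subst h1
      have hS : (Finset.univ.filter fun x : G => x ^ 1 = 1) = {1} := by
        ext x
        simp only [Finset.mem_filter, Finset.mem_univ, true_and, pow_one, Finset.mem_singleton]
      rw [hS, Finset.card_singleton]
    · set p := n.minFac with hp_def
      have hp : p.Prime := Nat.minFac_prime h1
      obtain ⟨m, hnm⟩ : p ∣ n := Nat.minFac_dvd n
      have hm0 : 0 < m := Nat.pos_of_ne_zero fun h0 => by rw [h0, mul_zero] at hnm; omega
      have hmn : m < n := by
        have h2 : 2 ≤ p := hp.two_le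
        nlinarith
      set Sn := Finset.univ.filter fun x : G => x ^ n = 1 with hSn
      set Sm := Finset.univ.filter fun x : G => x ^ m = 1 with hSm
      set Sp := Finset.univ.filter fun x : G => x ^ p = 1 with hSp
      have himage : Sn.image (fun x => x ^ p) ⊆ Sm := by
        intro y hy
        obtain ⟨x, hx, rfl⟩ := Finset.mem_image.1 hy
        simp only [hSn, hSm, Finset.mem_filter, Finset.mem_univ, true_and] at hx ⊢
        rw [← pow_mul, ← hnm, hx]
      have hfib : ∀ y ∈ Sn.image (fun x => x ^ p), (Sn.filter fun x => x ^ p = y).card ≤ p := by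
        intro y hy
        obtain ⟨x₀, -, rfl⟩ := Finset.mem_image.1 hy
        refine le_trans (Finset.card_le_card_of_injOn (fun x => x * x₀⁻¹) ?_ ?_) (h p hp)
        · intro x hx
          simp only [Finset.coe_filter, Finset.mem_univ, true_and, Set.mem_setOf_eq] at hx ⊢
          rw [mul_pow, inv_pow, hx.2, mul_inv_cancel]
        · intro x _ x' _ hxx'
          exact mul_right_cancel hxx'
      calc Sn.card ≤ p * (Sn.image fun x => x ^ p).card := Finset.card_le_mul_card_image _ _ hfib
        _ ≤ p * Sm.card := Nat.mul_le_mul_left _ (Finset.card_le_card himage)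
        _ ≤ p * m := Nat.mul_le_mul_left _ (ih m hmn hm0)
        _ = n := hnm.symm

/-- **A finite commutative group with at most `p` solutions of `x^p = 1` for every prime `p` is cyclic**
(Mathlib `isCyclic_of_card_pow_eq_one_le` + the prime-wise counting criterion). [folklore] -/
theorem isCyclic_of_forall_prime_card_le
    (h : ∀ p : ℕ, p.Prime → (Finset.univ.filter fun x : G => x ^ p = 1).card ≤ p) : IsCyclic G :=
  isCyclic_of_card_pow_eq_one_le fun n hn => card_filter_pow_eq_one_le h n hn

/-- **A non-cyclic finite commutative group has a prime `p` with more than `p` solutions of `x^p = 1`.**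
[folklore] -/
theorem exists_prime_card_lt_of_not_isCyclic (hG : ¬ IsCyclic G) :
    ∃ p : ℕ, p.Prime ∧ p < (Finset.univ.filter fun x : G => x ^ p = 1).card := by
  by_contra hne
  exact hG (isCyclic_of_forall_prime_card_le fun p hp => not_lt.1 fun h => hne ⟨p, hp, h⟩)

/-! ## §2 Every non-cyclic finite commutative group of order `2^{a+1} m`, `m` odd, `m ≠ 1` -/

/-- **Non-cyclic with an odd part ⟹ a primitive CM set killed by an odd character.**  Let `G` be a finite
commutative group of order `2^{a+1} m`, `m` odd, `m ≠ 1`, `c ∈ G` an involution, `G` NOT cyclic.  Then there are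
a CM set `T ⊆ G` for `c` with trivial stabiliser and an odd character `χ` with `Σ_T χ = 0` (§1: a prime `p` with
more than `p` solutions of `x^p = 1`; `p = 2`: atom B with an odd prime `q ∣ m` (Cauchy); `p` odd: atom A).
[cite: Kubota1965, §4 Lemma 2] [cite: Shimura1998, §8.2 Prop. 26] [cite: Dodson1984, §3.2.1] -/
theorem exists_cmset_char_of_not_isCyclic {c : G} (hc1 : c ≠ 1) (hcc : c * c = 1) {a m : ℕ} (hm : Odd m)
    (hm1 : m ≠ 1) (hcard : Fintype.card G = 2 ^ (a + 1) * m) (hG : ¬ IsCyclic G) :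
    ∃ (T : Finset G) (χ : AddChar (Additive G) ℂ), (∀ g : G, g ∈ T ↔ c * g ∉ T) ∧
      (∀ w : G, w ≠ 1 → ∃ x : G, ¬ (x ∈ T ↔ w * x ∈ T)) ∧ χ (Additive.ofMul c) = -1 ∧
      ∑ g ∈ T, χ (Additive.ofMul g) = 0 := by
  obtain ⟨p, hp, hlt⟩ := exists_prime_card_lt_of_not_isCyclic hG
  haveI : Fact p.Prime := ⟨hp⟩
  set S := Finset.univ.filter fun x : G => x ^ p = 1 with hS
  have hmemS : ∀ x : G, x ∈ S ↔ x ^ p = 1 := fun x => by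
    simp only [hS, Finset.mem_filter, Finset.mem_univ, true_and]
  by_cases hp2 : p = 2
  · -- a second involution, and an element of odd prime order `q ∣ m`
    subst hp2
    have hlt' : ({1, c} : Finset G).card < S.card := lt_of_le_of_lt Finset.card_le_two hlt
    obtain ⟨t, htS, ht⟩ := Finset.exists_mem_notMem_of_card_lt_card hlt'
    simp only [Finset.mem_insert, Finset.mem_singleton, not_or] at ht
    have htt : t * t = 1 := by rw [← pow_two]; exact (hmemS t).1 htS
    obtain ⟨q, hq, hqm⟩ := Nat.exists_prime_and_dvd hm1
    haveI : Fact q.Prime := ⟨hq⟩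
    have hqodd : Odd q := hm.of_dvd_nat hqm
    have hq2 : q ≠ 2 := fun h => by rw [h] at hqodd; exact (Nat.not_odd_iff_even.2 even_two) hqodd
    have hqcard : q ∣ Fintype.card G := by rw [hcard]; exact Dvd.dvd.mul_left hqm _
    obtain ⟨u, hu⟩ := exists_prime_orderOf_dvd_card q hqcard
    have h3 : 3 ≤ orderOf u := by
      rw [hu]
      have h2 := hq.two_le
      omega
    exact exists_cmset_char_of_involution hc1 hcc ht.1 ht.2 htt (hu ▸ hqodd) h3
  · -- two independent elements of order `p`
    have hlt1 : ({1} : Finset G).card < S.card := by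
      rw [Finset.card_singleton]
      exact lt_trans hp.one_lt hlt
    obtain ⟨u, huS, hu1⟩ := Finset.exists_mem_notMem_of_card_lt_card hlt1
    rw [Finset.mem_singleton] at hu1
    have hu : orderOf u = p := orderOf_eq_prime ((hmemS u).1 huS) hu1
    have hltu : ((Finset.range p).image fun k => u ^ k).card < S.card :=
      lt_of_le_of_lt (le_trans Finset.card_image_le (Finset.card_range p).le) hlt
    obtain ⟨v, hvS, hvim⟩ := Finset.exists_mem_notMem_of_card_lt_card hltu
    have hv1 : v ≠ 1 := by
      intro h
      apply hvim
      rw [h]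
      exact Finset.mem_image.2 ⟨0, Finset.mem_range.2 hp.pos, pow_zero u⟩
    have hv : orderOf v = p := orderOf_eq_prime ((hmemS v).1 hvS) hv1
    have huv : v ∉ Subgroup.zpowers u := by
      intro h
      apply hvim
      rw [← hu]
      exact mem_powers_iff_mem_range_orderOf.1 (mem_powers_iff_mem_zpowers.2 h)
    exact exists_cmset_char_of_pair hc1 hcc hp hp2 hu hv huv

end Group

/-! ## §3 Abelian CM fields whose degree has an odd part -/

section Field

variable {K : Type} [Field K] [NumberField K] [IsCMField K] [IsGalois ℚ K]

omit [IsCMField K] [IsGalois ℚ K] in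
/-- Primitivity of a CM type does not depend on the base embedding (`K/ℚ` Galois: the `Aut(ℂ)`-translates of the
type separate ALL embeddings, Shimura §8.2 Prop. 26 as `isPrimitive_iff_forall_eq`). [cite: Shimura1998, §8.2
Prop. 26] -/
theorem isPrimitive_of_isPrimitive (Φ : CMType K) {φ₀ φ₁ : K →+* ℂ} (h : IsPrimitive (ℂ ≃+* ℂ) Φ.1 φ₁) :
    IsPrimitive (ℂ ≃+* ℂ) Φ.1 φ₀ := by
  haveI := isPretransitive_ringEquiv_complex (K := K)
  exact (isPrimitive_iff_forall_eq Φ.1 φ₀).2 ((isPrimitive_iff_forall_eq Φ.1 φ₁).1 h)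

/-- **NECESSITY, non-cyclic case.**  An abelian CM field `K` of degree `2^{a+1} m`, `m` odd, `m ≠ 1`, whose Galois
group is NOT cyclic has a PRIMITIVE DEGENERATE CM type (part IIIa on `Gal(K/ℚ)` + Kubota's Lemma 2, part I).
[cite: Kubota1965, §4 Lemma 2] [cite: Shimura1998, §8.2 Prop. 26] -/
theorem exists_isPrimitive_not_isNondegenerate_of_not_isCyclic (hcomm : ∀ g h : K ≃ₐ[ℚ] K, g * h = h * g)
    {a m : ℕ} (hm : Odd m) (hm1 : m ≠ 1) (hK : Module.finrank ℚ K = 2 ^ (a + 1) * m)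
    (hG : ¬ IsCyclic (K ≃ₐ[ℚ] K)) (φ₀ : K →+* ℂ) :
    ∃ Φ : CMType K, IsPrimitive (ℂ ≃+* ℂ) Φ.1 φ₀ ∧ ¬ IsNondegenerate Φ := by
  letI : CommGroup (K ≃ₐ[ℚ] K) := { (inferInstance : Group (K ≃ₐ[ℚ] K)) with mul_comm := hcomm }
  have hcard : Fintype.card (K ≃ₐ[ℚ] K) = 2 ^ (a + 1) * m := by
    rw [Fintype.card_congr (Equiv.ofBijective (embOf φ₀) (embOf_bijective φ₀)), NumberField.Embeddings.card, hK]
  obtain ⟨T, χ, hcm, hprim, hχc, hχT⟩ :=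
    exists_cmset_char_of_not_isCyclic (complexConj_restrictScalars_ne_one (K := K)) complexConj_mul_self hm hm1
      hcard hG
  obtain ⟨Φ, hΦprim, hΦdeg, -⟩ :=
    exists_isPrimitive_not_isNondegenerate_of_galoisFinset_char hcomm T hcm hprim χ hχc hχT φ₀
  exact ⟨Φ, hΦprim, hΦdeg⟩

/-- **THE CLASSIFICATION, degrees with an odd part.**  `K` abelian CM of degree `2^{a+1} m`, `m` odd, `m ≠ 1`:
every PRIMITIVE CM type of `K` is nondegenerate **iff** `Gal(K/ℚ)` is cyclic and `m` is prime.  (⟸ gen 11;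
cyclic ∧ composite: gen 12; non-cyclic: `exists_isPrimitive_not_isNondegenerate_of_not_isCyclic`.)
[cite: Kubota1965, §4 Lemma 2] [cite: Dodson1984, §3.1.1, §3.2.1] [cite: Shimura1998, §8.2 Prop. 26] -/
theorem forall_isPrimitive_isNondegenerate_iff_of_ne_one (hcomm : ∀ g h : K ≃ₐ[ℚ] K, g * h = h * g)
    {a m : ℕ} (hm : Odd m) (hm1 : m ≠ 1) (hK : Module.finrank ℚ K = 2 ^ (a + 1) * m) (φ₀ : K →+* ℂ) :
    (∀ Φ : CMType K, IsPrimitive (ℂ ≃+* ℂ) Φ.1 φ₀ → IsNondegenerate Φ) ↔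
      IsCyclic (K ≃ₐ[ℚ] K) ∧ m.Prime := by
  constructor
  · intro h
    have hcyc : IsCyclic (K ≃ₐ[ℚ] K) := by
      by_contra hG
      obtain ⟨Φ, hprim, hdeg⟩ := exists_isPrimitive_not_isNondegenerate_of_not_isCyclic hcomm hm hm1 hK hG φ₀
      exact hdeg (h Φ hprim)
    have hall : ∀ (Φ : CMType K) (φ₁ : K →+* ℂ), IsPrimitive (ℂ ≃+* ℂ) Φ.1 φ₁ → IsNondegenerate Φ :=
      fun Φ φ₁ hprim => h Φ (isPrimitive_of_isPrimitive Φ hprim)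
    exact ⟨hcyc, ((forall_isPrimitive_isNondegenerate_iff_of_isCyclic hcyc hm hK).1 hall).resolve_left hm1⟩
  · rintro ⟨hcyc, hp⟩ Φ hprim
    have hm2 : m ≠ 2 := fun h => by
      rw [h] at hm
      exact (Nat.not_odd_iff_even.2 even_two) hm
    exact isNondegenerate_of_isPrimitive_of_isCyclic hcyc hp hm2 hK Φ φ₀ hprim

/-- **THE COMPLETE CLASSIFICATION OF ABELIAN CM FIELDS (primitive types).**  `K` abelian CM of degree
`2^{a+1} m`, `m` odd, `c` = complex conjugation: every PRIMITIVE CM type of `K` is nondegenerate **iff**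
EITHER `m = 1` and ((α) `c` lies in a cyclic subgroup of `Gal(K/ℚ)` of index `≤ 2`, or (β) `[K:ℚ] ≤ 8`, or
(γ) `[K:ℚ] = 16` and every Galois automorphism squares to `1` or `c`) OR `m` is prime and `Gal(K/ℚ)` is cyclic.
[cite: Kubota1965, §4 Lemma 2] [cite: Gordon1999HodgeAVSurvey, §9.4.3 (Theorem [B.140])] [cite: Dodson1984,
§3.2.1] [cite: Shimura1998, §8.2 Prop. 26] -/
theorem forall_isPrimitive_isNondegenerate_iff_abelian (hcomm : ∀ g h : K ≃ₐ[ℚ] K, g * h = h * g) {a m : ℕ}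
    (hm : Odd m) (hK : Module.finrank ℚ K = 2 ^ (a + 1) * m) (φ₀ : K →+* ℂ) :
    (∀ Φ : CMType K, IsPrimitive (ℂ ≃+* ℂ) Φ.1 φ₀ → IsNondegenerate Φ) ↔
      (m = 1 ∧ ((∃ z : K ≃ₐ[ℚ] K, (IsCMField.complexConj K).restrictScalars ℚ ∈ Subgroup.zpowers z ∧
          (Subgroup.zpowers z).index ≤ 2) ∨ Module.finrank ℚ K ≤ 8 ∨
        (Module.finrank ℚ K = 16 ∧
          ∀ g : K ≃ₐ[ℚ] K, g * g = 1 ∨ g * g = (IsCMField.complexConj K).restrictScalars ℚ))) ∨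
      (m.Prime ∧ IsCyclic (K ≃ₐ[ℚ] K)) := by
  by_cases hm1 : m = 1
  · subst hm1
    rw [mul_one] at hK
    rw [AbelianTwoPowerClassification.forall_isPrimitive_isNondegenerate_iff hcomm hK φ₀]
    constructor
    · intro h
      exact Or.inl ⟨rfl, h⟩
    · rintro (⟨-, h⟩ | ⟨h, -⟩)
      · exact h
      · exact absurd h Nat.not_prime_one
  · rw [forall_isPrimitive_isNondegenerate_iff_of_ne_one hcomm hm hm1 hK φ₀]
    constructor
    · rintro ⟨hc, hp⟩
      exact Or.inr ⟨hp, hc⟩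
    · rintro (⟨h, -⟩ | ⟨hp, hc⟩)
      · exact absurd h hm1
      · exact ⟨hc, hp⟩

/-! ## §4 Simple CM abelian varieties -/

omit [IsGalois ℚ K] in
/-- Simple realisations ⟷ primitive types: a property of all primitive types is a property of all types realised by
a SIMPLE abelian variety (Shimura §8.2 Prop. 26 = tree `isSimple_iff_isPrimitive`; existence of realisations =
tree `cmAbelianVarietyRealised_holds`). [cite: Shimura1998, §6.2 Thm. 3 and §8.2 Prop. 26] -/
theorem forall_isSimple_iff_forall_isPrimitive (φ₀ : K →+* ℂ) :
    (∀ (Φ : CMType K) (A : AbelianVariety ℂ) (ι : 𝓞 K →+* End A) (θ : K →+* Module.End ℂ (complexBetti A.X 1)),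
        IsCMTypeRealisation Φ A ι θ → A.IsSimple → IsNondegenerate Φ) ↔
      ∀ Φ : CMType K, IsPrimitive (ℂ ≃+* ℂ) Φ.1 φ₀ → IsNondegenerate Φ := by
  constructor
  · intro h Φ hprim
    obtain ⟨A, ι, θ, hA, hs, -⟩ := exists_simple_realisation_of_isPrimitive Φ φ₀ hprim
    exact h Φ A ι θ hA hs
  · intro h Φ A ι θ hA hs
    exact h Φ ((isSimple_iff_isPrimitive hA φ₀).1 hs)

/-- **THE COMPLETE CLASSIFICATION OF ABELIAN CM FIELDS (simple abelian varieties).**  `K` abelian CM of degree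
`2^{a+1} m`, `m` odd: every SIMPLE abelian variety with complex multiplication by `K` is nondegenerate — `Hdg = Div`
on all its powers, the Hodge conjecture for all its powers — **iff** (`m = 1` ∧ ((α) ∨ (β) ∨ (γ))) ∨
(`m` prime ∧ `Gal(K/ℚ)` cyclic). [cite: Shimura1998, §6.2 Thm. 3 and §8.2 Prop. 26] [cite: Kubota1965, §4 Lemma 2]
[cite: Gordon1999HodgeAVSurvey, Thm. 6.4 and §9.4.3] [cite: Dodson1984, §3.2.1] -/
theorem forall_isSimple_isNondegenerate_iff_abelian (hcomm : ∀ g h : K ≃ₐ[ℚ] K, g * h = h * g) {a m : ℕ}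
    (hm : Odd m) (hK : Module.finrank ℚ K = 2 ^ (a + 1) * m) :
    (∀ (Φ : CMType K) (A : AbelianVariety ℂ) (ι : 𝓞 K →+* End A) (θ : K →+* Module.End ℂ (complexBetti A.X 1)),
        IsCMTypeRealisation Φ A ι θ → A.IsSimple → IsNondegenerate Φ) ↔
      (m = 1 ∧ ((∃ z : K ≃ₐ[ℚ] K, (IsCMField.complexConj K).restrictScalars ℚ ∈ Subgroup.zpowers z ∧
          (Subgroup.zpowers z).index ≤ 2) ∨ Module.finrank ℚ K ≤ 8 ∨
        (Module.finrank ℚ K = 16 ∧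
          ∀ g : K ≃ₐ[ℚ] K, g * g = 1 ∨ g * g = (IsCMField.complexConj K).restrictScalars ℚ))) ∨
      (m.Prime ∧ IsCyclic (K ≃ₐ[ℚ] K)) := by
  obtain ⟨φ₀⟩ := (inferInstance : Nonempty (K →+* ℂ))
  rw [forall_isSimple_iff_forall_isPrimitive φ₀]
  exact forall_isPrimitive_isNondegenerate_iff_abelian hcomm hm hK φ₀

/-- **The degrees with an odd part, on simple abelian varieties**: `m` odd, `m ≠ 1`: every simple abelian variety
with CM by `K` is nondegenerate iff `Gal(K/ℚ)` is cyclic and `m` is prime. [cite: Shimura1998, §8.2 Prop. 26]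
[cite: Kubota1965, §4 Lemma 2] -/
theorem forall_isSimple_isNondegenerate_iff_of_ne_one (hcomm : ∀ g h : K ≃ₐ[ℚ] K, g * h = h * g) {a m : ℕ}
    (hm : Odd m) (hm1 : m ≠ 1) (hK : Module.finrank ℚ K = 2 ^ (a + 1) * m) :
    (∀ (Φ : CMType K) (A : AbelianVariety ℂ) (ι : 𝓞 K →+* End A) (θ : K →+* Module.End ℂ (complexBetti A.X 1)),
        IsCMTypeRealisation Φ A ι θ → A.IsSimple → IsNondegenerate Φ) ↔
      IsCyclic (K ≃ₐ[ℚ] K) ∧ m.Prime := by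
  obtain ⟨φ₀⟩ := (inferInstance : Nonempty (K →+* ℂ))
  rw [forall_isSimple_iff_forall_isPrimitive φ₀]
  exact forall_isPrimitive_isNondegenerate_iff_of_ne_one hcomm hm hm1 hK φ₀

variable {Φ : CMType K} {A : AbelianVariety ℂ} {ι : 𝓞 K →+* End A} {θ : K →+* Module.End ℂ (complexBetti A.X 1)}

/-- **THE HODGE CONJECTURE FOR EVERY POWER OF EVERY SIMPLE ABELIAN VARIETY WITH CM BY AN ABELIAN CM FIELD OF DEGREE
`2^{a+1}·p`, `p` an odd prime, with CYCLIC Galois group** — unconditionally (gen 11 by name, Hazama/Gordon 6.4 on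
the nondegenerate type); e.g. `ℚ(ζ_7)`, `ℚ(ζ_{11})`, `ℚ(ζ_{13})`, `ℚ(ζ_{23})`, every cyclic CM field of degree
`6, 10, 12, 14, 20, 22, 24, 26, 28, 40, …`. [cite: Gordon1999HodgeAVSurvey, 5.13 (i) and Thm. 6.4]
[cite: Kubota1965, §4 Lemma 2] -/
theorem hodgeConjectureFor_pow_of_isSimple_of_isCyclic (hcyc : IsCyclic (K ≃ₐ[ℚ] K)) {a m : ℕ} (hm : Odd m)
    (hp : m.Prime) (hK : Module.finrank ℚ K = 2 ^ (a + 1) * m) (hA : IsCMTypeRealisation Φ A ι θ)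
    (hs : A.IsSimple) (N : ℕ) : HodgeConjectureFor (⨁ fun _ : Fin N => A).dim (⨁ fun _ : Fin N => A).X := by
  obtain ⟨φ₀⟩ := (inferInstance : Nonempty (K →+* ℂ))
  have hm2 : m ≠ 2 := fun h => by
    rw [h] at hm
    exact (Nat.not_odd_iff_even.2 even_two) hm
  exact (isNondegenerate_of_isPrimitive_of_isCyclic hcyc hp hm2 hK Φ φ₀
    ((isSimple_iff_isPrimitive hA φ₀).1 hs)).hodgeConjectureFor_pow hA N

/-- **Bad case, non-cyclic: a SIMPLE DEGENERATE CM abelian variety of dimension `[K:ℚ]/2 = 2^a m` exists**, with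
an exceptional Hodge class (rational, of type `(k,k)`, outside the complexified divisor ring) on some power.
[cite: Shimura1998, §6.2 Thm. 3 and §8.2 Prop. 26] [cite: Gordon1999HodgeAVSurvey, Thm. 6.4 and §9.4.2] -/
theorem exists_simple_degenerate_of_not_isCyclic (hcomm : ∀ g h : K ≃ₐ[ℚ] K, g * h = h * g) {a m : ℕ}
    (hm : Odd m) (hm1 : m ≠ 1) (hK : Module.finrank ℚ K = 2 ^ (a + 1) * m) (hG : ¬ IsCyclic (K ≃ₐ[ℚ] K)) :
    ∃ (Φ : CMType K) (φ₀ : K →+* ℂ) (A : AbelianVariety ℂ) (ι : 𝓞 K →+* End A)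
      (θ : K →+* Module.End ℂ (complexBetti A.X 1)),
      IsPrimitive (ℂ ≃+* ℂ) Φ.1 φ₀ ∧ ¬ IsNondegenerate Φ ∧ IsCMTypeRealisation Φ A ι θ ∧ A.IsSimple ∧
      A.dim = 2 ^ a * m ∧
      ∃ N k : ℕ, ∃ x : complexBetti (⨁ fun _ : Fin N => A).X (2 * k), IsRationalClass x ∧
        IsOfHodgeType (⨁ fun _ : Fin N => A).dim (⨁ fun _ : Fin N => A).X (2 * k) k k x ∧
        x ∉ divisorClassesSpan (⨁ fun _ : Fin N => A).X (⨁ fun _ : Fin N => A).dim k := by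
  obtain ⟨φ₀⟩ := (inferInstance : Nonempty (K →+* ℂ))
  obtain ⟨Φ, hprim, hdeg⟩ := exists_isPrimitive_not_isNondegenerate_of_not_isCyclic hcomm hm hm1 hK hG φ₀
  obtain ⟨A, ι, θ, hA, hs, hdim⟩ := exists_simple_realisation_of_isPrimitive Φ φ₀ hprim
  refine ⟨Φ, φ₀, A, ι, θ, hprim, hdeg, hA, hs, ?_, exists_exceptional_pow_of_not_isNondegenerate φ₀ hprim hdeg hA⟩
  rw [hdim, hK, pow_succ, mul_assoc, mul_comm 2 m, ← mul_assoc, Nat.mul_div_cancel _ (by norm_num : 0 < 2)]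

/-- **Bad case, all of it**: `m` odd, `m ≠ 1`, and NOT (cyclic with `m` prime) ⟹ a simple degenerate CM abelian
variety of dimension `2^a m` with an exceptional Hodge class on a power. [cite: Shimura1998, §6.2 Thm. 3 and
§8.2 Prop. 26] [cite: Dodson1984, §3.2.1] [cite: Gordon1999HodgeAVSurvey, Thm. 6.4] -/
theorem exists_simple_degenerate_of_ne_one (hcomm : ∀ g h : K ≃ₐ[ℚ] K, g * h = h * g) {a m : ℕ}
    (hm : Odd m) (hm1 : m ≠ 1) (hK : Module.finrank ℚ K = 2 ^ (a + 1) * m)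
    (hbad : ¬ (IsCyclic (K ≃ₐ[ℚ] K) ∧ m.Prime)) :
    ∃ (Φ : CMType K) (φ₀ : K →+* ℂ) (A : AbelianVariety ℂ) (ι : 𝓞 K →+* End A)
      (θ : K →+* Module.End ℂ (complexBetti A.X 1)),
      IsPrimitive (ℂ ≃+* ℂ) Φ.1 φ₀ ∧ ¬ IsNondegenerate Φ ∧ IsCMTypeRealisation Φ A ι θ ∧ A.IsSimple ∧
      ∃ N k : ℕ, ∃ x : complexBetti (⨁ fun _ : Fin N => A).X (2 * k), IsRationalClass x ∧
        IsOfHodgeType (⨁ fun _ : Fin N => A).dim (⨁ fun _ : Fin N => A).X (2 * k) k k x ∧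
        x ∉ divisorClassesSpan (⨁ fun _ : Fin N => A).X (⨁ fun _ : Fin N => A).dim k := by
  obtain ⟨φ₀⟩ := (inferInstance : Nonempty (K →+* ℂ))
  have h := (forall_isPrimitive_isNondegenerate_iff_of_ne_one hcomm hm hm1 hK φ₀).not.2 hbad
  push Not at h
  obtain ⟨Φ, hprim, hdeg⟩ := h
  obtain ⟨A, ι, θ, hA, hs, -⟩ := exists_simple_realisation_of_isPrimitive Φ φ₀ hprim
  exact ⟨Φ, φ₀, A, ι, θ, hprim, hdeg, hA, hs, exists_exceptional_pow_of_not_isNondegenerate φ₀ hprim hdeg hA⟩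

end Field

end Summit.HodgeConjecture.CorCM.AbelianOddPart

end
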